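import Summits.Ventures.CertifiedManyBodySolver.Downfold.EmeryShapeTrueCornerRule
import Summits.Ventures.CertifiedManyBodySolver.Downfold.EmeryFermiScalePointsHg1212K26TrueCorners
import Summits.Ventures.CertifiedManyBodySolver.Downfold.EmeryFermiScalePointsHg1212K26VirtualCorners
import HarnessLib

/-!
# THE ONE-BAND FERMI-SURFACE SHAPE `t′/t` OF THE WHOLE TYPED 3BE BOX `emeryBoxHg1212K26Src (EmeryBoxesKSlicesG)` AT ITS TWO TRUE CORNERS (true-corner rule under certified margins, §B.87 (i);
# router/EMERY-SHAPE-CORNERS.tsv «true» rows)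

Venture CertifiedManyBodySolver, cell `pub/hubbard-downfold` (stage S1; INFLATION-RULES-3to1-B §B.87 (i)), seat hubbard-downfold-mod-4 (technique B, g35); namespace
`Summit.Ventures.CertifiedManyBodySolver.Downfold.Emery`. Everything PROVED (0 sorry). WHAT THIS IS NOT: a statement about HgBa₂CaCu₂O₆₊δ plane ((K) source box) — the typed box is SCREENING-GRADE; `U = 0`
one-body kinematics of the σ model; object E = the EXACT `t–t′` shape of the σ Fermi surface at the row's own Fermi energy.

For EVERY one-body row of `[1.85, 2.45] × [1.205, 1.28] × [0.644, 0.663] × [0.163, 0.187]` eV the one-band `t′/t` lies between its values at the TRUE corners `(Δ₁, a₁, b₂, c₂)` and `(Δ₂, a₂, b₁, c₁)`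
(`EmeryShapeTrueCornerRule`; the t_pp / t_pp′ directions by the MARGIN LEVERS of `EmeryMarginLevers`, margins certified by `norm_num` with the constants `M` printed below), read
over their K = 384 brackets (`EmeryFermiScalePointsHg1212K26TrueCorners`).

| filling | **true-corner window (certified)** | margins (t_pp lower/upper; t_pp′ lower/upper) | two-ray (§B.86 (i)) | g19 sub-box device |
|---|---|---|---|---|
| n_H = 1.16 (ν = 21/50) | **[-0.3053, -0.2697]** | M_b 0.4064 / 0.5182; M_c 0.0 / 0.2582 | see EmeryBoxesHg1212K26ShapeCorners | [-0.3064,-0.2689] (n_H band) |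
| n_H = 1.20 (ν = 2/5) | **[-0.3053, -0.2698]** | M_b 0.4423 / 0.5526; M_c 0.0 / 0.2163 | see EmeryBoxesHg1212K26ShapeCorners | [-0.3064,-0.2689] (n_H band) |

Sources: three-band model [HybertsenSchluterChristensen1989, Eq. (1)]; [AndersenEtAl1995, §6]; box rows as cited in the typed object's file.
-/

noncomputable section

namespace Summit.Ventures.CertifiedManyBodySolver.Downfold.Emery

open Real Set

/-- **n_H = 1.16 (ν = 21/50): for every row of the box the one-band Fermi-surface `t′/t` (object E) lies in `[-0.3053, -0.2697]` — its values at the two TRUE corners** (margin levers; margins by `norm_num`). [folklore] -/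
theorem hg1212K26Box_fsRatio_true_nH116 {Δ a b c : ℝ} (hΔ : Δ ∈ Icc ((37 : ℝ) / 20) ((49 : ℝ) / 20)) (ha : a ∈ Icc ((241 : ℝ) / 200) ((32 : ℝ) / 25)) (hb : b ∈ Icc ((161 : ℝ) / 250) ((663 : ℝ) / 1000)) (hc : c ∈ Icc ((163 : ℝ) / 1000) ((187 : ℝ) / 1000)) :
    fsRatio Δ a b c (fermiEnergyOf Δ a b c ((21 : ℝ) / 50)) ∈ Icc ((-3053 : ℝ) / 10000) ((-2697 : ℝ) / 10000) := by
  have hSL := (fermiEnergyOf_of_pointBracketCheck truePt_Hg1212K26SL_nH116_br (by norm_num) (by norm_num) (by norm_num) (ν := (21/50 : ℝ)) (by push_cast; exact ⟨le_rfl, le_rfl⟩)).2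
  have hTL := (fermiEnergyOf_of_pointBracketCheck truePt_Hg1212K26TL_nH116_br (by norm_num) (by norm_num) (by norm_num) (ν := (21/50 : ℝ)) (by push_cast; exact ⟨le_rfl, le_rfl⟩)).2
  have hSU := (fermiEnergyOf_of_pointBracketCheck truePt_Hg1212K26SU_nH116_br (by norm_num) (by norm_num) (by norm_num) (ν := (21/50 : ℝ)) (by push_cast; exact ⟨le_rfl, le_rfl⟩)).2
  have hQU := (fermiEnergyOf_of_pointBracketCheck truePt_Hg1212K26QU_nH116_br (by norm_num) (by norm_num) (by norm_num) (ν := (21/50 : ℝ)) (by push_cast; exact ⟨le_rfl, le_rfl⟩)).2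
  have hTH := (fermiEnergyOf_of_pointBracketCheck truePt_Hg1212K26TH_nH116_br (by norm_num) (by norm_num) (by norm_num) (ν := (21/50 : ℝ)) (by push_cast; exact ⟨le_rfl, le_rfl⟩)).2
  have hAlo := (fermiEnergyOf_of_pointBracketCheck virtPt_Hg1212K26Alo_nH116_br (by norm_num) (by norm_num) (by norm_num) (ν := (21/50 : ℝ)) (by push_cast; exact ⟨le_rfl, le_rfl⟩)).2
  have hTop := (fermiEnergyOf_of_pointBracketCheck virtPt_Hg1212K26H_nH116_br (by norm_num) (by norm_num) (by norm_num) (ν := (21/50 : ℝ)) (by push_cast; exact ⟨le_rfl, le_rfl⟩)).2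
  push_cast at hSL hTL hSU hQU hTH hAlo hTop
  norm_num at hSL hTL hSU hQU hTH hAlo hTop
  obtain ⟨hΔl, hΔu⟩ := hΔ
  obtain ⟨hal, hau⟩ := ha
  constructor
  · have hlow := fsRatio_fermiEnergyOf_trueCorner_lower (Δ₁ := ((37 : ℝ) / 20)) (a₁ := ((241 : ℝ) / 200)) (b₁ := ((161 : ℝ) / 250)) (b₂ := ((663 : ℝ) / 1000)) (c₁ := ((163 : ℝ) / 1000)) (c₂ := ((187 : ℝ) / 1000))
      (ν := ((21 : ℝ) / 50)) (pL := ((7629 : ℝ) / 5000)) (qL := ((15611 : ℝ) / 10000)) (Mb := ((254 : ℝ) / 625)) (Mc := (0 : ℝ)) (by norm_num) hΔl (by norm_num) hal (by norm_num) hb (by norm_num) hc (by norm_num) (by norm_num) (by norm_num)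
      (by norm_num) hSL.1 hAlo.2 (by norm_num) (by norm_num [fsD, fsN]) (by norm_num) (by norm_num) (by norm_num [fsD, fsN]) (by norm_num) (by norm_num [dopingDisc]) (by norm_num [fsD, fsN])
    refine le_trans ?_ hlow
    have hw := (fsRatio_mem_Icc_on_window_of_dopingDisc_nonpos (Δ := ((37 : ℝ) / 20)) (a := ((241 : ℝ) / 200)) (b := ((663 : ℝ) / 1000)) (c := ((187 : ℝ) / 1000))
      (p := ((15309 : ℝ) / 10000)) (q := ((15409 : ℝ) / 10000)) (by norm_num) (by norm_num) (by norm_num) (by norm_num) (by norm_num) (by norm_num) (by norm_num) (by norm_num [dopingDisc]) hTL).1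
    refine le_trans ?_ hw
    norm_num [fsRatio, fsD, fsN]
  · have hup := fsRatio_fermiEnergyOf_trueCorner_upper (Δ₁ := ((37 : ℝ) / 20)) (Δ₂ := ((49 : ℝ) / 20)) (a₁ := ((241 : ℝ) / 200)) (a₂ := ((32 : ℝ) / 25)) (b₁ := ((161 : ℝ) / 250)) (b₂ := ((663 : ℝ) / 1000)) (c₁ := ((163 : ℝ) / 1000)) (c₂ := ((187 : ℝ) / 1000))
      (ν := ((21 : ℝ) / 50)) (pU := ((3693 : ℝ) / 2500)) (qU := ((7549 : ℝ) / 5000)) (qT := ((8463 : ℝ) / 5000)) (Mb := ((2591 : ℝ) / 5000)) (Mc := ((1291 : ℝ) / 5000)) (by norm_num) ⟨hΔl, hΔu⟩ (by norm_num) ⟨hal, hau⟩ (by norm_num) hb (by norm_num) hc (by norm_num) (by norm_num) (by norm_num)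
      hTop.2 (by norm_num) (by norm_num) hSU.1 hQU.2 (by norm_num) (by norm_num [fsD, fsN]) (by norm_num) (by norm_num) (by norm_num [fsD, fsN]) (by norm_num) (by norm_num) (by norm_num [fsD, fsN])
    refine le_trans hup ?_
    have hw := (fsRatio_mem_Icc_on_window_of_dopingDisc_nonpos (Δ := ((49 : ℝ) / 20)) (a := ((32 : ℝ) / 25)) (b := ((161 : ℝ) / 250)) (c := ((163 : ℝ) / 1000))
      (p := ((14953 : ℝ) / 10000)) (q := ((15053 : ℝ) / 10000)) (by norm_num) (by norm_num) (by norm_num) (by norm_num) (by norm_num) (by norm_num) (by norm_num) (by norm_num [dopingDisc]) hTH).2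
    refine le_trans hw ?_
    norm_num [fsRatio, fsD, fsN]

/-- **n_H = 1.20 (ν = 2/5): for every row of the box the one-band Fermi-surface `t′/t` (object E) lies in `[-0.3053, -0.2698]` — its values at the two TRUE corners** (margin levers; margins by `norm_num`). [folklore] -/
theorem hg1212K26Box_fsRatio_true_nH120 {Δ a b c : ℝ} (hΔ : Δ ∈ Icc ((37 : ℝ) / 20) ((49 : ℝ) / 20)) (ha : a ∈ Icc ((241 : ℝ) / 200) ((32 : ℝ) / 25)) (hb : b ∈ Icc ((161 : ℝ) / 250) ((663 : ℝ) / 1000)) (hc : c ∈ Icc ((163 : ℝ) / 1000) ((187 : ℝ) / 1000)) :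
    fsRatio Δ a b c (fermiEnergyOf Δ a b c ((2 : ℝ) / 5)) ∈ Icc ((-3053 : ℝ) / 10000) ((-1349 : ℝ) / 5000) := by
  have hSL := (fermiEnergyOf_of_pointBracketCheck truePt_Hg1212K26SL_nH120_br (by norm_num) (by norm_num) (by norm_num) (ν := (2/5 : ℝ)) (by push_cast; exact ⟨le_rfl, le_rfl⟩)).2
  have hTL := (fermiEnergyOf_of_pointBracketCheck truePt_Hg1212K26TL_nH120_br (by norm_num) (by norm_num) (by norm_num) (ν := (2/5 : ℝ)) (by push_cast; exact ⟨le_rfl, le_rfl⟩)).2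
  have hSU := (fermiEnergyOf_of_pointBracketCheck truePt_Hg1212K26SU_nH120_br (by norm_num) (by norm_num) (by norm_num) (ν := (2/5 : ℝ)) (by push_cast; exact ⟨le_rfl, le_rfl⟩)).2
  have hQU := (fermiEnergyOf_of_pointBracketCheck truePt_Hg1212K26QU_nH120_br (by norm_num) (by norm_num) (by norm_num) (ν := (2/5 : ℝ)) (by push_cast; exact ⟨le_rfl, le_rfl⟩)).2
  have hTH := (fermiEnergyOf_of_pointBracketCheck truePt_Hg1212K26TH_nH120_br (by norm_num) (by norm_num) (by norm_num) (ν := (2/5 : ℝ)) (by push_cast; exact ⟨le_rfl, le_rfl⟩)).2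
  have hAlo := (fermiEnergyOf_of_pointBracketCheck virtPt_Hg1212K26Alo_nH120_br (by norm_num) (by norm_num) (by norm_num) (ν := (2/5 : ℝ)) (by push_cast; exact ⟨le_rfl, le_rfl⟩)).2
  have hTop := (fermiEnergyOf_of_pointBracketCheck virtPt_Hg1212K26H_nH120_br (by norm_num) (by norm_num) (by norm_num) (ν := (2/5 : ℝ)) (by push_cast; exact ⟨le_rfl, le_rfl⟩)).2
  push_cast at hSL hTL hSU hQU hTH hAlo hTop
  norm_num at hSL hTL hSU hQU hTH hAlo hTop
  obtain ⟨hΔl, hΔu⟩ := hΔ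
  obtain ⟨hal, hau⟩ := ha
  constructor
  · have hlow := fsRatio_fermiEnergyOf_trueCorner_lower (Δ₁ := ((37 : ℝ) / 20)) (a₁ := ((241 : ℝ) / 200)) (b₁ := ((161 : ℝ) / 250)) (b₂ := ((663 : ℝ) / 1000)) (c₁ := ((163 : ℝ) / 1000)) (c₂ := ((187 : ℝ) / 1000))
      (ν := ((2 : ℝ) / 5)) (pL := ((3723 : ℝ) / 2500)) (qL := ((3809 : ℝ) / 2500)) (Mb := ((4423 : ℝ) / 10000)) (Mc := (0 : ℝ)) (by norm_num) hΔl (by norm_num) hal (by norm_num) hb (by norm_num) hc (by norm_num) (by norm_num) (by norm_num)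
      (by norm_num) hSL.1 hAlo.2 (by norm_num) (by norm_num [fsD, fsN]) (by norm_num) (by norm_num) (by norm_num [fsD, fsN]) (by norm_num) (by norm_num [dopingDisc]) (by norm_num [fsD, fsN])
    refine le_trans ?_ hlow
    have hw := (fsRatio_mem_Icc_on_window_of_dopingDisc_nonpos (Δ := ((37 : ℝ) / 20)) (a := ((241 : ℝ) / 200)) (b := ((663 : ℝ) / 1000)) (c := ((187 : ℝ) / 1000))
      (p := ((14933 : ℝ) / 10000)) (q := ((15033 : ℝ) / 10000)) (by norm_num) (by norm_num) (by norm_num) (by norm_num) (by norm_num) (by norm_num) (by norm_num) (by norm_num [dopingDisc]) hTL).1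
    refine le_trans ?_ hw
    norm_num [fsRatio, fsD, fsN]
  · have hup := fsRatio_fermiEnergyOf_trueCorner_upper (Δ₁ := ((37 : ℝ) / 20)) (Δ₂ := ((49 : ℝ) / 20)) (a₁ := ((241 : ℝ) / 200)) (a₂ := ((32 : ℝ) / 25)) (b₁ := ((161 : ℝ) / 250)) (b₂ := ((663 : ℝ) / 1000)) (c₁ := ((163 : ℝ) / 1000)) (c₂ := ((187 : ℝ) / 1000))
      (ν := ((2 : ℝ) / 5)) (pU := ((7221 : ℝ) / 5000)) (qU := ((14763 : ℝ) / 10000)) (qT := ((8271 : ℝ) / 5000)) (Mb := ((2763 : ℝ) / 5000)) (Mc := ((2163 : ℝ) / 10000)) (by norm_num) ⟨hΔl, hΔu⟩ (by norm_num) ⟨hal, hau⟩ (by norm_num) hb (by norm_num) hc (by norm_num) (by norm_num) (by norm_num)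
      hTop.2 (by norm_num) (by norm_num) hSU.1 hQU.2 (by norm_num) (by norm_num [fsD, fsN]) (by norm_num) (by norm_num) (by norm_num [fsD, fsN]) (by norm_num) (by norm_num) (by norm_num [fsD, fsN])
    refine le_trans hup ?_
    have hw := (fsRatio_mem_Icc_on_window_of_dopingDisc_nonpos (Δ := ((49 : ℝ) / 20)) (a := ((32 : ℝ) / 25)) (b := ((161 : ℝ) / 250)) (c := ((163 : ℝ) / 1000))
      (p := ((914 : ℝ) / 625)) (q := ((3681 : ℝ) / 2500)) (by norm_num) (by norm_num) (by norm_num) (by norm_num) (by norm_num) (by norm_num) (by norm_num) (by norm_num [dopingDisc]) hTH).2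
    refine le_trans hw ?_
    norm_num [fsRatio, fsD, fsN]

end Summit.Ventures.CertifiedManyBodySolver.Downfold.Emery
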